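import Summits.QuantumFields.BalabanUV.Beta.GAN24.LegPushNest
import Summits.QuantumFields.BalabanUV.Beta.GAN24.Lin4LegTowerUnroll
import Summits.QuantumFields.BalabanUV.Beta.GAN24.Push4Iter
import Summits.QuantumFields.BalabanUV.Beta.GAN24.Push3Nest

/-!
# `BalabanUV.Beta.GAN24.LegChainPush` — binder row G-an2-4 ∕ (CONV-C), W-slot, the (α-0) parity re-cut, located crux (Q-L-k₀) (RULING R-gan24p1-g36-1 (5)(C)):
# **leaf-03's k₀-FOLD LEG CHAIN IS ONE THREE-LEG PUSH THROUGH THE COMPOSITE LEGS** —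
# `Lin4LegTowerUnroll.legChain kc K N m (k+1) W = (Π_{j ≤ k} kc (m+j)) • legPush (kChain (krow ∘ K) m k) (Push4Iter.legChain (colH ∘ K) m k) W`
# (`LegStepPush.legStep_eq_smul_legPush` at each level, `LegPushNest.legPush_legPush` to merge; leaf-01 g43's `Push3Nest.transport_push₃` pattern).

NOT IN PRINT; OUR BOOKKEEPING ([folklore]; one plumbing `def` (`kChain`, the composite full-row kernel leg) asserting nothing; 0 cited facts, 0 `def … : Prop`,
0 sorry, 0 wall binders).  HONEST FRAMING (cell contract, verbatim): «discharging `BetaPertH` makes Bałaban's UV stability UNCONDITIONAL — a real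
constructive-QFT result; it is NOT the continuum limit and NOT the Clay problem.»  HONEST DEPENDENCY (verbatim): «continuum YM on T⁴ ⇐ BetaPertH ∧ nine
spine estimates (0/9 proved); BetaPertH ⇐ (D1) ∧ (D4) ∧ CAP+tail; G-an2-4 gates asym, D1 and NE2/3/4.»

## What is proved (generic `d`)
* §1 `kChain l m k` (`kChain l m 0 = l m`, `kChain l m (k+1) = kcomp (kChain l m k) (l (m+k+1))` — the shape of leaf-17's `Push4Iter.legChain`);
  `kcomp_eq_legComp` (a composite full-row leg IS a `legComp` of ordinary leg families, fibre by fibre), hence `klegDecay_kcomp` ∕ **`klegDecay_kChain`**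
  (localised at a positive rate at blocking `N^(k+1)`, from `Push4NestAux.legDecay_legComp` ∕ `Push4Iter.legDecay_legChain`'s recursion); `klegDecay_krow`
  (the full multiplier row of a decaying kernel is localised); `legPush_smul`.
* §2 **`legChain_succ_eq_smul_legPush`** — for kernels `K j` decaying at positive rates, `N ≥ 1`, and a `LocStencil₂` table `W` at a positive rate:
  `Lin4LegTowerUnroll.legChain kc K N m (k+1) W = (∏_{j ∈ range (k+1)} kc (m+j)) • legPush (kChain (fun j ↦ krow (K j) N) m k) (Push4Iter.legChain (fun j ↦ colH (K j) N) m k) W`.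
With leaf-03 g60's `transport_legStepB_eq` ∕ `bsumPow_eq_bsum_pow` the (Q-L-k₀) window's object `legChain … n k₀ ∘ bsumPow Lc k₀` is thus ONE `legPush` of
`bsum (Lc^{k₀}) ∘ W` through the composite legs — the shape `LegStepPush.locStencil₂_legPush_bsum` bounds (given the composite legs' envelopes: (b1) +
leaf-12 for the slot legs, the OWNER g36's block-ℓ¹ row for the dressed kernel leg).  NOT (H1♮); discharges NOTHING of (Q-L) ∕ (C) ∕ «T2Shape» ∕ «T2Drift» ∕
(hW, hWall); NEVER «G-an2-4 closed» as (CONV-C); NOT D1, NOT `BetaPertH`, NOT continuum, NOT Clay; not in print.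
Unit `b2b-balaban-gan24-formalise-leaf-01` (G-an2-4 formalisation swarm, leaf prover 01, gen 74), 2026-08-23.
-/

noncomputable section

open Finset
open scoped BigOperators
open Literature.MathematicalPhysics.QuantumFieldTheory.Balaban1983to89
open Literature.MathematicalPhysics.QuantumFieldTheory.Balaban1983to89.Beta
open B12Sec2to5 (l1 l1_nonneg)
open ExpKernelCalculus (MKer Decays comp Zl Zl_nonneg Zl_pos l1_sub_symm)
open OneStepResolventKernel (Fib)
open OneStepKernelFamily (colH)
open BalabanCompositeJets (LocStencil₂ LocStencil₂.nonneg)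
open Summit.QuantumFields.BalabanUV.Beta.GAN24.BiStencilZeroMode (Tab)
open Summit.QuantumFields.BalabanUV.Beta.GAN24.Push4 (legComp legComp_apply vertexW vertexW_apply vertex2W)
open Summit.QuantumFields.BalabanUV.Beta.GAN24.Push4Bounds (LegDecay LegDecay.nonneg LegDecay.abs_le LegDecay.summable legDecay_colH)
open Summit.QuantumFields.BalabanUV.Beta.GAN24.Push4NestAux (legDecay_legComp)
open Summit.QuantumFields.BalabanUV.Beta.GAN24.Push4Iter (LegFam legDecay_legChain)
open Summit.QuantumFields.BalabanUV.Beta.GAN24.Push3Nest (legDecay_mono)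
open Summit.QuantumFields.BalabanUV.Beta.GAN24.Lin4LegTower (legStep)
open Summit.QuantumFields.BalabanUV.Beta.GAN24.LegStepPush (krow legPush legPush_inl legPush_inr legStep_eq_smul_legPush)
open Summit.QuantumFields.BalabanUV.Beta.GAN24.LegPushNestAux (Kk kcomp legPush_eq_comp_Kk)
open Summit.QuantumFields.BalabanUV.Beta.GAN24.LegPushNest (legPush_legPush exists_legDecay_legComp comp_smul_right)

namespace Summit.QuantumFields.BalabanUV.Beta.GAN24.LegChainPush

variable {d : ℕ}

/-! ## §1 The composite full-row kernel leg and its localisation -/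

/-- [folklore] Plumbing `def`: **THE COMPOSITE FULL-ROW KERNEL LEG** of levels `m, …, m+k` — `kChain l m 0 = l m`, `kChain l m (k+1) = kcomp (kChain l m k) (l (m+k+1))`. -/
def kChain (l : ℕ → Fin (d + 1) → (Fin (d + 1) → ℤ) → Fib d → (Fin (d + 1) → ℤ) → ℝ) (m : ℕ) :
    ℕ → Fin (d + 1) → (Fin (d + 1) → ℤ) → Fib d → (Fin (d + 1) → ℤ) → ℝ
  | 0 => l m
  | k + 1 => kcomp (kChain l m k) (l (m + k + 1))

/-- [folklore] `kChain`, base. -/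
@[simp] theorem kChain_zero (l : ℕ → Fin (d + 1) → (Fin (d + 1) → ℤ) → Fib d → (Fin (d + 1) → ℤ) → ℝ) (m : ℕ) : kChain l m 0 = l m := rfl

/-- [folklore] `kChain`, step. -/
@[simp] theorem kChain_succ (l : ℕ → Fin (d + 1) → (Fin (d + 1) → ℤ) → Fib d → (Fin (d + 1) → ℤ) → ℝ) (m k : ℕ) :
    kChain l m (k + 1) = kcomp (kChain l m k) (l (m + k + 1)) := rfl

/-- [folklore] **A COMPOSITE FULL-ROW LEG IS A `legComp`, FIBRE BY FIBRE**: `kcomp l₂ l₁ α x″ f x = legComp (fun α′ x′ _ x ↦ l₂ α′ x′ f x) (fun α x″ α′ x′ ↦ l₁ α x″ (inl α′) x′) α x″ κ x`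
(any dummy `κ`). -/
theorem kcomp_eq_legComp (l₂ l₁ : Fin (d + 1) → (Fin (d + 1) → ℤ) → Fib d → (Fin (d + 1) → ℤ) → ℝ) (α : Fin (d + 1)) (x'' : Fin (d + 1) → ℤ) (f : Fib d)
    (x : Fin (d + 1) → ℤ) (κ : Fin (d + 1)) :
    kcomp l₂ l₁ α x'' f x = legComp (fun α' x' (_ : Fin (d + 1)) x => l₂ α' x' f x) (fun α x'' α' x' => l₁ α x'' (Sum.inl α') x') α x'' κ x := by
  rw [kcomp, legComp_apply]

/-- [folklore] **THE COMPOSITE FULL-ROW LEG IS LOCALISED** (leaf-17's `legDecay_legComp` through `kcomp_eq_legComp`): outer `l₁` at blocking `N₁` (rate `m₁`), inner `l₂` at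
`N₂` (rate `m₂`), a common rate `m′ ≤ m₂` with `m′·N₂ < m₁`. -/
theorem klegDecay_kcomp {l₁ l₂ : Fin (d + 1) → (Fin (d + 1) → ℤ) → Fib d → (Fin (d + 1) → ℤ) → ℝ} {N₁ N₂ : ℕ} {Cl₁ Cl₂ m₁ m₂ m' : ℝ}
    (hl₁ : ∀ α x' f x, |l₁ α x' f x| ≤ Cl₁ * Real.exp (-m₁ * l1 (x - (N₁ : ℤ) • x')))
    (hl₂ : ∀ α x' f x, |l₂ α x' f x| ≤ Cl₂ * Real.exp (-m₂ * l1 (x - (N₂ : ℤ) • x'))) (hm'0 : 0 ≤ m') (hm'₂ : m' ≤ m₂) (hm'₁ : m' * N₂ < m₁)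
    (α : Fin (d + 1)) (x'' : Fin (d + 1) → ℤ) (f : Fib d) (x : Fin (d + 1) → ℤ) :
    |kcomp l₂ l₁ α x'' f x| ≤ ((d + 1 : ℕ) * (Cl₁ * Cl₂ * Zl (d + 1) (m₁ - m' * N₂))) * Real.exp (-m' * l1 (x - ((N₂ * N₁ : ℕ) : ℤ) • x'')) := by
  have h₁ : LegDecay (fun α x'' α' x' => l₁ α x'' (Sum.inl α') x') N₁ Cl₁ m₁ := fun α x'' α' x' => hl₁ α x'' (Sum.inl α') x'
  have h₂ : LegDecay (fun α' x' (_ : Fin (d + 1)) x => l₂ α' x' f x) N₂ Cl₂ m₂ := fun α' x' _ x => hl₂ α' x' f x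
  rw [kcomp_eq_legComp l₂ l₁ α x'' f x 0]
  exact legDecay_legComp h₁ h₂ hm'0 hm'₂ hm'₁ α x'' 0 x

/-- [folklore] **THE COMPOSITE FULL-ROW KERNEL LEG OF THE CHAIN IS LOCALISED AT A POSITIVE RATE** at blocking `N^(k+1)` (every constant existential). -/
theorem klegDecay_kChain {l : ℕ → Fin (d + 1) → (Fin (d + 1) → ℤ) → Fib d → (Fin (d + 1) → ℤ) → ℝ} {N : ℕ}
    (hl : ∀ j, ∃ C m : ℝ, 0 < m ∧ ∀ α x' f x, |l j α x' f x| ≤ C * Real.exp (-m * l1 (x - (N : ℤ) • x'))) (m₀ : ℕ) :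
    ∀ k, ∃ C m : ℝ, 0 < m ∧ ∀ α x' f x, |kChain l m₀ k α x' f x| ≤ C * Real.exp (-m * l1 (x - ((N ^ (k + 1) : ℕ) : ℤ) • x'))
  | 0 => by
    obtain ⟨C, m, hm, h⟩ := hl m₀
    exact ⟨C, m, hm, by simpa [kChain_zero, pow_one] using h⟩
  | k + 1 => by
    obtain ⟨C₂, m₂, hm₂, h₂⟩ := klegDecay_kChain hl m₀ k
    obtain ⟨C₁, m₁, hm₁, h₁⟩ := hl (m₀ + k + 1)
    -- a common rate
    obtain ⟨m', hm'0, hm'₂, hm'₁⟩ : ∃ m' : ℝ, 0 < m' ∧ m' ≤ m₂ ∧ m' * (N ^ (k + 1) : ℕ) < m₁ := by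
      refine ⟨min m₂ (m₁ / (2 * (((N ^ (k + 1) : ℕ) : ℝ) + 1))), lt_min hm₂ (by positivity), min_le_left _ _, ?_⟩
      have hN : (0 : ℝ) ≤ ((N ^ (k + 1) : ℕ) : ℝ) := Nat.cast_nonneg _
      have hpos : (0 : ℝ) < 2 * (((N ^ (k + 1) : ℕ) : ℝ) + 1) := by positivity
      have e1 : min m₂ (m₁ / (2 * (((N ^ (k + 1) : ℕ) : ℝ) + 1))) * ((N ^ (k + 1) : ℕ) : ℝ)
          ≤ m₁ / (2 * (((N ^ (k + 1) : ℕ) : ℝ) + 1)) * ((N ^ (k + 1) : ℕ) : ℝ) := mul_le_mul_of_nonneg_right (min_le_right _ _) hN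
      have e2 : m₁ / (2 * (((N ^ (k + 1) : ℕ) : ℝ) + 1)) * ((N ^ (k + 1) : ℕ) : ℝ) < m₁ := by
        calc m₁ / (2 * (((N ^ (k + 1) : ℕ) : ℝ) + 1)) * ((N ^ (k + 1) : ℕ) : ℝ)
            < m₁ / (2 * (((N ^ (k + 1) : ℕ) : ℝ) + 1)) * (2 * (((N ^ (k + 1) : ℕ) : ℝ) + 1)) := mul_lt_mul_of_pos_left (by linarith) (div_pos hm₁ hpos)
          _ = m₁ := div_mul_cancel₀ _ hpos.ne'
      exact e1.trans_lt e2
    refine ⟨(d + 1 : ℕ) * (C₁ * C₂ * Zl (d + 1) (m₁ - m' * (N ^ (k + 1) : ℕ))), m', hm'0, fun α x' f x => ?_⟩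
    rw [kChain_succ, pow_succ]
    exact klegDecay_kcomp h₁ h₂ hm'0.le hm'₂ hm'₁ α x' f x

/-- [folklore] The full multiplier row of a decaying kernel is a localised full-row leg. -/
theorem klegDecay_krow {K : MKer (d + 1) (Fib d)} {C m : ℝ} (hK : Decays K C m) (N : ℕ) (α : Fin (d + 1)) (x' : Fin (d + 1) → ℤ) (f : Fib d)
    (x : Fin (d + 1) → ℤ) : |krow K N α x' f x| ≤ C * Real.exp (-m * l1 (x - (N : ℤ) • x')) := by
  rw [krow, l1_sub_symm]; exact hK _ _ _ _

/-- [folklore] A localised full-row leg stays localised at any smaller rate (same constant). -/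
theorem klegDecay_mono {l : Fin (d + 1) → (Fin (d + 1) → ℤ) → Fib d → (Fin (d + 1) → ℤ) → ℝ} {N : ℕ} {Cl m m' : ℝ}
    (hl : ∀ α x' f x, |l α x' f x| ≤ Cl * Real.exp (-m * l1 (x - (N : ℤ) • x'))) (hm' : m' ≤ m) :
    ∀ α x' f x, |l α x' f x| ≤ Cl * Real.exp (-m' * l1 (x - (N : ℤ) • x')) := by
  have hCl : 0 ≤ Cl := by
    have h0 := hl 0 0 (Sum.inl 0) ((N : ℤ) • (0 : Fin (d + 1) → ℤ))
    rw [sub_self, show l1 (0 : Fin (d + 1) → ℤ) = 0 by simp [l1], mul_zero, Real.exp_zero, mul_one] at h0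
    exact (abs_nonneg _).trans h0
  intro α x' f x
  exact (hl α x' f x).trans (mul_le_mul_of_nonneg_left (Real.exp_le_exp.2 (by nlinarith [l1_nonneg (x - (N : ℤ) • x')])) hCl)

/-- [folklore] The double vertex is homogeneous in the table. -/
theorem vertex2W_smul' (r : LegFam d) (c : ℝ) (X : Tab d) (μ : Fin (d + 1)) (y : Fin (d + 1) → ℤ) (ν : Fin (d + 1)) (y' : Fin (d + 1) → ℤ) :
    vertex2W r (c • X) μ y ν y' = c • vertex2W r X μ y ν y' := by
  funext x z a b
  simp only [vertex2W, vertexW_apply, Pi.smul_apply, smul_eq_mul]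
  symm
  rw [Finset.mul_sum]
  refine Finset.sum_congr rfl fun κ _ => ?_
  rw [← tsum_mul_left]
  refine tsum_congr fun u => ?_
  rw [← mul_assoc, mul_comm c, mul_assoc, Finset.mul_sum]
  congr 1
  refine Finset.sum_congr rfl fun κ' _ => ?_
  rw [← tsum_mul_left]
  exact tsum_congr fun u' => by ring

/-- [folklore] `legPush` is homogeneous in the table. -/
theorem legPush_smul (l : Fin (d + 1) → (Fin (d + 1) → ℤ) → Fib d → (Fin (d + 1) → ℤ) → ℝ) (r : LegFam d) (c : ℝ) (X : Tab d)
    (κ : Fin (d + 1)) (u : Fin (d + 1) → ℤ) (κ' : Fin (d + 1)) (u' : Fin (d + 1) → ℤ) :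
    legPush l r (c • X) κ u κ' u' = c • legPush l r X κ u κ' u' := by
  rw [legPush_eq_comp_Kk, legPush_eq_comp_Kk, vertex2W_smul', vertex2W_smul', ← smul_add, smul_comm, comp_smul_right]

/-! ## §2 The k-fold leg chain is one push through the composite legs -/

/-- NOT IN PRINT; OUR BOOKKEEPING.  **leaf-03's k-FOLD LEG CHAIN IS ONE THREE-LEG PUSH THROUGH THE COMPOSITE LEGS.**  For kernels `K j` decaying at positive rates,
`N ≥ 1`, and a `LocStencil₂` table at a positive rate:
`Lin4LegTowerUnroll.legChain kc K N m (k+1) W = (∏_{j ∈ range (k+1)} kc (m+j)) • legPush (kChain (fun j ↦ krow (K j) N) m k) (Push4Iter.legChain (fun j ↦ colH (K j) N) m k) W`. -/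
theorem legChain_succ_eq_smul_legPush {K : ℕ → MKer (d + 1) (Fib d)} {N : ℕ} (hN : 1 ≤ N) (hK : ∀ j, ∃ C m : ℝ, 0 < m ∧ Decays (K j) C m)
    (kc : ℕ → ℝ) {W : Tab d} (hW : ∃ C δ : ℝ, 0 < δ ∧ LocStencil₂ W C δ) (m : ℕ) :
    ∀ k, Lin4LegTowerUnroll.legChain kc K N m (k + 1) W
      = (∏ j ∈ Finset.range (k + 1), kc (m + j)) •
          legPush (kChain (fun j => krow (K j) N) m k) (Push4Iter.legChain (fun j => colH (K j) N) m k) W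
  | 0 => by
    rw [Finset.prod_range_one]
    funext κ u κ' u'
    show legStep (kc m) (K m) (K m) N W κ u κ' u' = (kc m • legPush (krow (K m) N) (colH (K m) N) W) κ u κ' u'
    rw [legStep_eq_smul_legPush]
  | k + 1 => by
    have ih := legChain_succ_eq_smul_legPush hN hK kc hW m k
    -- data for the nesting at the outer level `m + k + 1`
    have hkl : ∀ j, ∃ C m₁ : ℝ, 0 < m₁ ∧ ∀ α x' f x, |krow (K j) N α x' f x| ≤ C * Real.exp (-m₁ * l1 (x - (N : ℤ) • x')) := fun j => by
      obtain ⟨C, m₁, hm₁, h⟩ := hK j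
      exact ⟨C, m₁, hm₁, fun α x' f x => klegDecay_krow h N α x' f x⟩
    have hrl : ∀ j, ∃ C m₁ : ℝ, 0 < m₁ ∧ LegDecay (colH (K j) N) N C m₁ := fun j => by
      obtain ⟨C, m₁, hm₁, h⟩ := hK j
      exact ⟨C, m₁, hm₁, legDecay_colH h⟩
    obtain ⟨Cl₁, ml₁, hml₁, hl₁⟩ := hkl (m + k + 1)
    obtain ⟨Cr₁, mr₁, hmr₁, hr₁⟩ := hrl (m + k + 1)
    obtain ⟨CL, mL, hmL, hL⟩ := klegDecay_kChain hkl m k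
    obtain ⟨CR, mR, hmR, hR⟩ := legDecay_legChain hrl m k
    obtain ⟨C, δ, hδ, hWl⟩ := hW
    -- common rates per side
    have hm₁ : 0 < min ml₁ mr₁ := lt_min hml₁ hmr₁
    have hm₂ : 0 < min mL mR := lt_min hmL hmR
    have hl₁' := klegDecay_mono hl₁ (min_le_left ml₁ mr₁)
    have hr₁' := legDecay_mono hr₁ (min_le_right ml₁ mr₁)
    have hL' := klegDecay_mono hL (min_le_left mL mR)
    have hR' := legDecay_mono hR (min_le_right mL mR)
    -- the step
    funext κ u κ' u'
    show legStep (kc (m + k + 1)) (K (m + k + 1)) (K (m + k + 1)) N (Lin4LegTowerUnroll.legChain kc K N m (k + 1) W) κ u κ' u'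
      = ((∏ j ∈ Finset.range (k + 1 + 1), kc (m + j)) •
          legPush (kChain (fun j => krow (K j) N) m (k + 1)) (Push4Iter.legChain (fun j => colH (K j) N) m (k + 1)) W) κ u κ' u'
    rw [ih, legStep_eq_smul_legPush, kChain_succ, Push4Iter.legChain_succ]
    simp only [Pi.smul_apply]
    rw [legPush_smul, legPush_legPush hl₁' hL' hr₁' hR' hm₁ hm₂ hWl hδ κ u κ' u', smul_smul]
    congr 1
    rw [Finset.prod_range_succ (fun j => kc (m + j)) (k + 1), mul_comm, Nat.add_assoc]

end Summit.QuantumFields.BalabanUV.Beta.GAN24.LegChainPush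

end
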